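import Mathlib

/-!
# GaugeDescent, support item `TorusOrbitDescent` (stmt-ValiantsHypothesis-6635) — preliminaries

Route `GaugeDescent` of `ValiantsHypothesis`, support item `TorusOrbitDescent` ("Hilbert 90 descent
for split diagonal tori": a `ℚ`-closed set which is the union of the `T`-orbits of `N` points has a
point over a number field of degree `≤ N`). Two reusable ingredients of the intended proof:

1. **Galois orbit counting.** For a finite Galois extension `E/F` acting on any `G`-set `X`
   (`G = Gal(E/F)`), the fixed field of the stabiliser of `x` has degree over `F` equal to the size
   of the orbit of `x` (`finrank_fixedField_stabilizer`), hence `≤ #s` when the orbit stays in a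
   finite set `s` (`finrank_fixedField_stabilizer_le`); and every `G`-equivariant `E`-valued
   function of `x` lies in that fixed field (`apply_mem_fixedField_stabilizer`). (Also the piece
   shared with the Galois-descent step of `LangWeilTransfer.GoodReduction`, stmt-6377: the field
   generated by the coefficients of an absolutely irreducible factor has degree ≤ #geometric factors.)
2. **Torus-orbit invariants.** For the diagonal action `y ↦ (∏_l t_l^{A_{l v}} · y_v)_v` of
   `(Kˣ)^k` through an integer matrix `A`, the support of `y` is preserved and every Laurent monomial
   `∏_v y_v^{u_v}` with `A u = 0` is invariant (`prod_zpow_torusAct`).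
Honest framing: bookkeeping inside a dormant route whose crux is open; nothing here bears on
VP ≠ VNP.
-/

-- the summit and the problem share the name `ValiantsHypothesis` (D-0017 single-conjunct layout)
set_option linter.dupNamespace false

namespace Summit.ValiantsHypothesis.ValiantsHypothesis.Theorems.GaugeDescent

/-! ### Galois orbit counting -/

section Galois

variable {F E : Type*} [Field F] [Field E] [Algebra F E] [FiniteDimensional F E] [IsGalois F E]

/-- **The fixed field of a stabiliser has degree equal to the orbit size.** -/
theorem finrank_fixedField_stabilizer {X : Type*} [MulAction (E ≃ₐ[F] E) X] (x : X) :
    Module.finrank F (IntermediateField.fixedField (MulAction.stabilizer (E ≃ₐ[F] E) x)) =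
      (MulAction.orbit (E ≃ₐ[F] E) x).ncard := by
  set H := MulAction.stabilizer (E ≃ₐ[F] E) x with hH
  have h1 := Module.finrank_mul_finrank F (IntermediateField.fixedField H) E
  rw [IntermediateField.finrank_fixedField_eq_card, ← IsGalois.card_aut_eq_finrank (F := F) (E := E),
    ← Subgroup.card_mul_index H, mul_comm] at h1
  have hHpos : 0 < Nat.card H := Nat.card_pos
  have h2 : Module.finrank F (IntermediateField.fixedField H) = H.index :=
    Nat.eq_of_mul_eq_mul_left hHpos h1
  rw [h2, hH, MulAction.index_stabilizer]

/-- If the orbit of `x` stays inside a finite set `s`, the fixed field of the stabiliser of `x` has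
degree `≤ #s` over `F`. -/
theorem finrank_fixedField_stabilizer_le {X : Type*} [MulAction (E ≃ₐ[F] E) X] (x : X)
    {s : Finset X} (hs : ∀ g : E ≃ₐ[F] E, g • x ∈ s) :
    Module.finrank F (IntermediateField.fixedField (MulAction.stabilizer (E ≃ₐ[F] E) x)) ≤
      s.card := by
  rw [finrank_fixedField_stabilizer]
  calc (MulAction.orbit (E ≃ₐ[F] E) x).ncard ≤ (s : Set X).ncard := by
        refine Set.ncard_le_ncard ?_ s.finite_toSet
        rintro y ⟨g, rfl⟩
        exact hs g
    _ = s.card := Set.ncard_coe_finset s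

omit [FiniteDimensional F E] [IsGalois F E] in
/-- **Equivariant functions land in the fixed field of the stabiliser.** -/
theorem apply_mem_fixedField_stabilizer {X : Type*} [MulAction (E ≃ₐ[F] E) X] (x : X)
    (φ : X → E) (hφ : ∀ (g : E ≃ₐ[F] E) (y : X), φ (g • y) = g (φ y)) :
    φ x ∈ IntermediateField.fixedField (MulAction.stabilizer (E ≃ₐ[F] E) x) := by
  rw [IntermediateField.mem_fixedField_iff]
  intro g hg
  rw [MulAction.mem_stabilizer_iff] at hg
  rw [← hφ, hg]

omit [IsGalois F E] in
/-- The fixed field of the stabiliser is finite-dimensional over `F` (as is every intermediate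
field of the finite extension `E/F`). -/
theorem finiteDimensional_fixedField_stabilizer {X : Type*} [MulAction (E ≃ₐ[F] E) X] (x : X) :
    FiniteDimensional F (IntermediateField.fixedField (MulAction.stabilizer (E ≃ₐ[F] E) x)) :=
  inferInstance

end Galois

/-! ### Torus-orbit invariants -/

section Torus

variable {K : Type*} [Field K] {m k : ℕ}

/-- The diagonal torus action preserves the support. -/
theorem torusAct_eq_zero_iff (A : Fin k → Fin m → ℤ) (t : Fin k → Kˣ) (y : Fin m → K) (v : Fin m) :
    ((∏ l, t l ^ A l v : Kˣ) : K) * y v = 0 ↔ y v = 0 := by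
  rw [mul_eq_zero, or_iff_right (Units.ne_zero _)]

/-- The torus factor of a Laurent monomial with exponent vector in the kernel of `A` is trivial:
`∏_v (∏_l t_l^{A_{lv}})^{u_v} = 1` when `∑_v A_{lv} u_v = 0` for all `l`. -/
theorem prod_zpow_torusFactor_eq_one (A : Fin k → Fin m → ℤ) (t : Fin k → Kˣ) (u : Fin m → ℤ)
    (hu : ∀ l, ∑ v, A l v * u v = 0) :
    (∏ v, (∏ l, t l ^ A l v : Kˣ) ^ u v) = 1 := by
  calc (∏ v, (∏ l, t l ^ A l v : Kˣ) ^ u v)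
      = ∏ v, ∏ l, t l ^ (A l v * u v) := by
        refine Finset.prod_congr rfl fun v _ => ?_
        rw [← Finset.prod_zpow]
        exact Finset.prod_congr rfl fun l _ => (zpow_mul _ _ _).symm
    _ = ∏ l, ∏ v, t l ^ (A l v * u v) := Finset.prod_comm
    _ = ∏ l, t l ^ (∑ v, A l v * u v) := by
        refine Finset.prod_congr rfl fun l _ => ?_
        -- `∏_v a^{f v} = a^{∑_v f v}` in the commutative group `Kˣ`
        classical
        have hz : ∀ (a : Kˣ) (s : Finset (Fin m)) (f : Fin m → ℤ),
            (∏ v ∈ s, a ^ f v) = a ^ (∑ v ∈ s, f v) := by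
          intro a s f
          induction s using Finset.induction_on with
          | empty => simp
          | insert i s hi ih => rw [Finset.sum_insert hi, Finset.prod_insert hi, zpow_add, ih]
        exact hz _ _ _
    _ = 1 := by
        rw [Finset.prod_eq_one]
        intro l _
        rw [hu l, zpow_zero]

/-- **Invariance of the Laurent monomials on the kernel lattice** under the diagonal torus action:
`∏_v (t^{A}·y)_v^{u_v} = ∏_v y_v^{u_v}` whenever `∑_v A_{lv} u_v = 0` for every `l`. -/
theorem prod_zpow_torusAct (A : Fin k → Fin m → ℤ) (t : Fin k → Kˣ) (y : Fin m → K) (u : Fin m → ℤ)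
    (hu : ∀ l, ∑ v, A l v * u v = 0) :
    (∏ v, (((∏ l, t l ^ A l v : Kˣ) : K) * y v) ^ u v) = ∏ v, y v ^ u v := by
  simp_rw [mul_zpow, Finset.prod_mul_distrib]
  have h : (∏ v, (((∏ l, t l ^ A l v : Kˣ) : K)) ^ u v) = 1 := by
    have := congr_arg (fun w : Kˣ => (w : K)) (prod_zpow_torusFactor_eq_one A t u hu)
    simpa [Units.val_zpow_eq_zpow_val] using this
  rw [h, one_mul]

/-- Two points in the same torus orbit have the same Laurent-monomial invariants on the kernel
lattice of `A`. -/
theorem prod_zpow_eq_of_mem_orbit (A : Fin k → Fin m → ℤ) {y y' : Fin m → K}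
    (h : ∃ t : Fin k → Kˣ, ∀ v, y' v = ((∏ l, t l ^ A l v : Kˣ) : K) * y v) (u : Fin m → ℤ)
    (hu : ∀ l, ∑ v, A l v * u v = 0) :
    (∏ v, y' v ^ u v) = ∏ v, y v ^ u v := by
  obtain ⟨t, ht⟩ := h
  simp_rw [ht]
  exact prod_zpow_torusAct A t y u hu

end Torus

end Summit.ValiantsHypothesis.ValiantsHypothesis.Theorems.GaugeDescent
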